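import Summits.QuantumFields.YangMills.Theorems.UnitScaleTiltHalvingP1FlatCoreWindowSizes
import Summits.QuantumFields.YangMills.Theorems.UnitScaleTiltHalvingP1FlatCoreDP1OfTop
import Summits.QuantumFields.YangMills.Theorems.UnitScaleTiltHalvingP1FlatCoreSupplierTowers
import Literature.MathematicalPhysics.QuantumFieldTheory.Balaban1983to89.B8Eq191FlatStencils
import Literature.Analysis.Matrix.DetExp
import HarnessLib

/-!
# `hP1room` PROGRAMME (LEAD-H «H = hP1room» BOARD v1, RULING L-9 (1)), (A-1) STAGE 2: ★★★ THE SUPPLIER DOOR — THE FamilyDoor's PER-SITE ∃-BLOCK FROM ITS CONTENT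
# ROWS ONLY, in N05's own `ℤ³` currency (`A`, `λ`, the gauge-fixed field `W^λ`, `logCfg`), every definitional row discharged

Route `UnitScaleTilt`, crux K1 child «MinimiserStabilityRegPr» (stmt-QuantumFields-19200), registered stub `stub_halvingStep` (`BirthV10`), text
`hP1room ⟸ hSupU` (✓`HalvingP1FlatCoreFamilyDoor.p1FlatPillar'_room_of_suppliers`, STAGE 4 `hP1room_of_suppliers`).  Cell `ym3-torus` (HUMAN RULING D-0037: YM₃ on T³ is
ladder rung R3 — NOT d = 4, NOT a mass gap, NOT the Clay problem), width seat `ym-ust-20520-w3` gen 6 ((A-1) assembler).  `--supports stmt-QuantumFields-19200 --as helper`;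
THEOREMS ONLY (0 `def`, 0 `sorry`); count-neutral; nothing here claims `core′`, `hP1room`, `hSupU`, the stub, the crux or the gap.

THE STATEMENT (★★★ `hSup_of_contentRows`).  At one member∕site `(F, n < K, x₀)` with the route cube data `(ρ, S, M)`, J1b's window letters `(a, M′, ρ′)` (`h0 h1 ha hroomW`),
the member field `U`, and
* [torus side] a torus gauge `g` (the pre-gauge of the charted iterate `W₁ := (U♯)^g`), the effective-gauge tower `κf` of F3 ✓`P1FlatCoreFrameLinLipschitz.exists_effGaugeFun W₁`
  (its recursion `hκfs` and bottom values `hκf0` = F3's letters VERBATIM), the accumulated-frame tower `ν` and the pulled-back tower `gs′` ((T1)∕(T2) ✓`HalvingP1FlatCoreSupplierTowers`);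
* [N05's `ℤ³` side] the input one-form `A`, the Landau gauge function `λ`; write `η := L^{−(K−n)}`, `W^λ := mgauge 1 (e^{iλ})⁻¹ (e^{iηA})` (the gauge-fixed field of
  ✓`B8Prop5KLevelLetters`), `X₀ := logCfg η W^λ` (`= η⁻¹·i⁻¹·log W^λ`, ✓`B8Eq138LandauZd.logCfg`);
GIVEN ONLY THE CONTENT ROWS — (hAchart) `e^{iηA(z,ν)} = W₁⟨0+z, ν⟩` on the window bonds; (hnear) `‖W^λ(z,ν) − 1‖ ≤ 1∕4` there; (hLanW) N05's Landau condition of record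
`IsLandau138W L k η □₀ Λs 1 W^λ` at `□₀ := cube L a M′ ρ′ k 0`, `Λs := cubeLamS L a M′ ρ′ k k`; (htop) the top identity of ✓`P1FlatCoreTopStepTorus.hFP_kLevel_top_RD` for
`κf (((−i)λ) ∘ rep)`; (hCsu)∕(hlam)∕(hg) the `SU(2)` rows (the frame constant `C := (gs′ k y₀)⁻¹ ν k y₀`, `λ` Hermitian traceless, `g` special unitary); (hX1)∕(hX2) print's
(1.36) sizes of `X₀` on N05's level cubes (✓`HalvingP1FlatCoreWindowSizes.hsize_of_windowSizes` letters, constant `B₁ε₀`) —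
the TWELVE rows of the FamilyDoor's ∃-block hold with the witnesses `w := (C·κf m 0·g)⁻¹ ∘ cover` ((T3) ✓`exists_w_of_su2`), `X := C·X₀·C⁻¹`, `μ := C·μ₀·C⁻¹`, `g`,
`h′ := κf m 0`, `κ′ := κf m` (`m := ((−i)λ) ∘ rep`, so `h0′` is `rfl` and `hs′` is F3's recursion), `ν`, `gs′`.
MECHANISM.  §1: at the flat background the Landau stencils `covDivB`, `covLap`, `QT` are `ℂ`-linear with TRIVIAL transporters (✓`bgT_one`), hence commute with a constant
conjugation `Y ↦ C·Y·C⁻¹` (`IsLandau138` transfers with `μ ↦ C·μ·C⁻¹`).  §2: `e^{−iH} ∈ SU(2)` for Hermitian traceless `H` (Mathlib `exp_mem_unitary_of_mem_skewAdjoint` +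
✓`Literature.Analysis.Matrix.det_exp_eq_exp_trace`).  §3: the gauged window field IS `C·W^λ(z,ν)·C⁻¹` — (T3)'s two clauses, ✓`transl_add_e`, ✓`P1FlatCoreJunction.rep_transl_eq`∕`rep_shift`
(`λ ∘ rep ∘ cover = λ` at both ends of a window bond), `h0`, (hAchart) — so `hX` is ✓`B7Prop6Flat.mlog_conj`, `hWnear` is ✓`norm_conjR_le`, `hsize` is (R4) ✓p640579 on `X₀` moved
through `‖C·Y·C⁻¹‖ ≤ ‖Y‖`.  HONEST SCOPE: plumbing; every analytic row stays DISPLAYED; the suppliers are STAGE 3 (✓p636261 top step for `htop`∕`hLanW` via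
✓`isLandau138W_gaugeFixed_of_multiplier`, N05∕J3 for `hAchart`∕`hnear`∕(hX1)∕(hX2), the frame rows for `hCsu`).

References: T. Bałaban, CMP **99** (1985) 75–102 [Balaban1985RegularSpaces] (Thm 2 p.83, (1.36)–(1.38) p.82, (1.84)–(1.91) pp.90–98, Prop. 5 (1.107)–(1.108) p.94);
CMP **98** (1985) 17–51 [Balaban1985Averaging] ((8) p.19, (21)–(23) p.21, (55)–(57) p.27, (110) p.34); CMP **102** (1985) 277–309 [Balaban1985Variational] ((150)–(156) pp.301–302).
-/

set_option autoImplicit false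

noncomputable section

open scoped BigOperators Matrix.Norms.L2Operator

namespace Summit.QuantumFields.YangMills.Theorems.HalvingP1FlatCoreSupplierDoor

open Literature.MathematicalPhysics.QuantumFieldTheory.Balaban1983to89
open Literature.MathematicalPhysics.QuantumFieldTheory.Balaban1983to89.T3ContinuumYM3Torus
open NormedSpace
open Complex (I)
open MatrixLog (mlog)
open B5Eq118OneStroke (iterBlockOf)
open B7Prop1Explicit renaming Site → LSite
open B7Prop1Explicit (e expUnit val_expUnit val_inv_expUnit U1)
open B7Prop2Explicit (unitaryUnits mem_unitaryUnits unitaryUnits_le_U1)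
open B7Eq78Linearization (conjR conjR_apply conjR_add conjR_sub conjR_smul conjR_smul_real conjR_one)
open B7Eq92Concrete (mgauge mgauge_apply Rc Rc_one_apply)
open B8Ineq132 (covDeriv covDerivFwd norm_conjR_le conjR_sum)
open B8Eq131Cubes (cube gs)
open B8Eq119TwistedAxial (bgT bgT_one)
open B8Eq191FlatStencils (conjR_unitOne)
open B8Eq138LandauZd (covDivB covLap QT qprimeT1 QprimeT logCfg IsLandau138 IsLandau138W)
open B8Eq184Proof (gaugeExp cfgExp)
open B8CubeMemberZd (cubeLamS)
open B10Eq27TorusAxialLog (transl transl_add_e rel unitsField toUField suIncl gaugeActT gaugeActT_apply axialT)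
open B15Eq112TorusCover (lift)
open Node00 (coverAt)
open FlatCubeOpsText (IsLevWeight)
open FlatCubeSequenceAligned (cubeSeqMT3 cubeSetM)
open Summit.QuantumFields.YangMills.Theorems.Prop8ChartDoubleBar (dbarIterU vframeU)
open HalvingP1FlatCoreJunction (rep_transl_eq rep_shift)
open HalvingP1FlatCoreWindowSizes (hsize_of_windowSizes)
open HalvingP1FlatCoreSupplierTowers (exists_w_of_su2)
open Summit.QuantumFields.YangMills.Theorems (FlatMinimizerH.le_T3)
open Literature.Analysis.Matrix (det_exp_eq_exp_trace)

/-! ## §1 Constant conjugation commutes with the flat-background Landau stencils -/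

section FlatConj

variable {d : ℕ} {𝔸 : Type*} [NormedRing 𝔸] [NormedAlgebra ℂ 𝔸] [CompleteSpace 𝔸]

omit [NormedAlgebra ℂ 𝔸] [CompleteSpace 𝔸] in
/-- the indicator of a conjugated function is the conjugated indicator. [folklore] -/
theorem indicator_conjR (Ω : Set (LSite d)) (C : 𝔸ˣ) (f : LSite d → 𝔸) :
    Ω.indicator (fun y => conjR C (f y)) = fun y => conjR C (Ω.indicator f y) := by
  classical
  funext y
  by_cases hy : y ∈ Ω
  · rw [Set.indicator_of_mem hy, Set.indicator_of_mem hy]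
  · rw [Set.indicator_of_notMem hy, Set.indicator_of_notMem hy, conjR_apply, mul_zero, zero_mul]

omit [CompleteSpace 𝔸] in
/-- `D^η_{1,μ}(C·F·C⁻¹) = C·(D^η_{1,μ}F)·C⁻¹`. [cite: Balaban1985RegularSpaces, (1.1) p.76] -/
theorem covDerivFwd_one_conjR (η : ℝ) (C : 𝔸ˣ) (μ : Fin d) (F : LSite d → 𝔸) (x : LSite d) :
    covDerivFwd η (1 : LSite d → Fin d → 𝔸ˣ) μ (fun y => conjR C (F y)) x = conjR C (covDerivFwd η (1 : LSite d → Fin d → 𝔸ˣ) μ F x) := by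
  simp only [covDerivFwd, Pi.one_apply, conjR_unitOne, ← conjR_sub, ← conjR_smul_real]

omit [CompleteSpace 𝔸] in
/-- `D^{η*}_{1,ν}(C·F·C⁻¹) = C·(D^{η*}_{1,ν}F)·C⁻¹`. [cite: Balaban1985RegularSpaces, (1.1) p.76] -/
theorem covDeriv_one_conjR (η : ℝ) (C : 𝔸ˣ) (ν : Fin d) (F : LSite d → 𝔸) (x : LSite d) :
    covDeriv η (1 : LSite d → Fin d → 𝔸ˣ) ν (fun y => conjR C (F y)) x = conjR C (covDeriv η (1 : LSite d → Fin d → 𝔸ˣ) ν F x) := by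
  simp only [covDeriv, Pi.one_apply, inv_one, conjR_unitOne, ← conjR_sub, ← conjR_smul_real]

omit [CompleteSpace 𝔸] in
/-- `D^{η*}_1(C·A·C⁻¹) = C·(D^{η*}_1 A)·C⁻¹`. [cite: Balaban1985RegularSpaces, (1.38) p.82] -/
theorem covDivB_one_conjR (η : ℝ) (C : 𝔸ˣ) (A : LSite d → Fin d → 𝔸) (x : LSite d) :
    covDivB η (1 : LSite d → Fin d → 𝔸ˣ) (fun z μ => conjR C (A z μ)) x = conjR C (covDivB η (1 : LSite d → Fin d → 𝔸ˣ) A x) := by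
  simp only [covDivB, conjR_sum]
  exact Finset.sum_congr rfl fun μ _ => covDeriv_one_conjR η C μ (fun z => A z μ) x

omit [CompleteSpace 𝔸] in
/-- `Δ^η_1(C·f·C⁻¹) = C·(Δ^η_1 f)·C⁻¹`. [cite: Balaban1985BackgroundPropagators, (3.23) p.394] -/
theorem covLap_one_conjR (η : ℝ) (C : 𝔸ˣ) (f : LSite d → 𝔸) (x : LSite d) :
    covLap η (1 : LSite d → Fin d → 𝔸ˣ) (fun y => conjR C (f y)) x = conjR C (covLap η (1 : LSite d → Fin d → 𝔸ˣ) f x) := by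
  unfold covLap
  have h : (fun z μ => covDerivFwd η (1 : LSite d → Fin d → 𝔸ˣ) μ (fun y => conjR C (f y)) z) =
      fun z μ => conjR C (covDerivFwd η (1 : LSite d → Fin d → 𝔸ˣ) μ f z) := by
    funext z μ; exact covDerivFwd_one_conjR η C μ f z
  rw [h, covDivB_one_conjR]

/-- one transpose step at the flat background commutes with constant conjugation (✓`bgT_one`). [cite: Balaban1985BackgroundPropagators, (3.19) p.393] -/
theorem qprimeT1_one_conjR (L : ℕ) (C : 𝔸ˣ) (j : ℕ) (f : LSite d → 𝔸) (x : LSite d) :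
    qprimeT1 L (1 : LSite d → Fin d → 𝔸ˣ) j (fun y => conjR C (f y)) x = conjR C (qprimeT1 L (1 : LSite d → Fin d → 𝔸ˣ) j f x) := by
  simp only [qprimeT1, bgT_one, inv_one, conjR_unitOne, conjR_smul_real]

/-- `Q′_j(1)ᵀ` commutes with constant conjugation. [cite: Balaban1985BackgroundPropagators, (3.19) p.393] -/
theorem QprimeT_one_conjR (L : ℕ) (C : 𝔸ˣ) :
    ∀ (j : ℕ) (f : LSite d → 𝔸) (x : LSite d),
      QprimeT L (1 : LSite d → Fin d → 𝔸ˣ) j (fun y => conjR C (f y)) x = conjR C (QprimeT L (1 : LSite d → Fin d → 𝔸ˣ) j f x) := by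
  intro j
  induction j with
  | zero => intro f x; rfl
  | succ j ih =>
    intro f x
    have h1 : qprimeT1 L (1 : LSite d → Fin d → 𝔸ˣ) j (fun y => conjR C (f y)) =
        fun y => conjR C (qprimeT1 L (1 : LSite d → Fin d → 𝔸ˣ) j f y) := funext (qprimeT1_one_conjR L C j f)
    show QprimeT L 1 j (qprimeT1 L 1 j (fun y => conjR C (f y))) x = conjR C (QprimeT L 1 j (qprimeT1 L 1 j f) x)
    rw [h1]
    exact ih _ x

/-- `Q′(1)ᵀ(C·μ·C⁻¹) = C·(Q′(1)ᵀμ)·C⁻¹`. [cite: Balaban1985BackgroundPropagators, (3.24) p.394] -/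
theorem QT_one_conjR (L m : ℕ) (Λs : ℕ → Set (LSite d)) (C : 𝔸ˣ) (μ : ℕ → LSite d → 𝔸) (x : LSite d) :
    QT L m Λs (1 : LSite d → Fin d → 𝔸ˣ) (fun j y => conjR C (μ j y)) x = conjR C (QT L m Λs (1 : LSite d → Fin d → 𝔸ˣ) μ x) := by
  simp only [QT, conjR_sum]
  refine Finset.sum_congr rfl fun j _ => ?_
  have h : (Λs j).indicator (fun y => conjR C (μ j y)) = fun y => conjR C ((Λs j).indicator (μ j) y) := indicator_conjR (Λs j) C (μ j)
  rw [h, QprimeT_one_conjR]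

/-- **(1.38) IN MULTIPLIER FORM AT THE FLAT BACKGROUND IS CONJUGATION-COVARIANT**: `IsLandau138 L m η Ω₀ Λs 1 X → IsLandau138 L m η Ω₀ Λs 1 (C·X·C⁻¹)` (multiplier `C·μ·C⁻¹`).
[cite: Balaban1985RegularSpaces, (1.38) p.82] -/
theorem isLandau138_one_conjR {L m : ℕ} {η : ℝ} {Ω₀ : Set (LSite d)} {Λs : ℕ → Set (LSite d)} (C : 𝔸ˣ) {X : LSite d → Fin d → 𝔸}
    (h : IsLandau138 L m η Ω₀ Λs (1 : LSite d → Fin d → 𝔸ˣ) X) :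
    IsLandau138 L m η Ω₀ Λs (1 : LSite d → Fin d → 𝔸ˣ) (fun z ν => conjR C (X z ν)) := by
  obtain ⟨μ, hμ⟩ := h
  refine ⟨fun j y => conjR C (μ j y), fun x hx => ?_⟩
  have h1 : covDivB η (1 : LSite d → Fin d → 𝔸ˣ) (fun z ν => conjR C (X z ν)) = fun y => conjR C (covDivB η (1 : LSite d → Fin d → 𝔸ˣ) X y) :=
    funext (covDivB_one_conjR η C X)
  rw [h1, indicator_conjR, covLap_one_conjR, hμ x hx, QT_one_conjR]

end FlatConj

/-! ## §2 `SU(2)` bookkeeping -/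

section SU2

/-- **`e^{−iH} ∈ SU(2)` FOR HERMITIAN TRACELESS `H`** (`−iH` is skew-adjoint ⇒ unitary; Liouville `det e^X = e^{tr X}` ⇒ `det = 1`).
[cite: Balaban1985Averaging, (21)-(23) p.21; Balaban1985Variational, (152) p.301] -/
theorem exp_neg_I_smul_mem_specialUnitaryGroup {H : Matrix (Fin 2) (Fin 2) ℂ} (hsa : IsSelfAdjoint H) (htr : H.trace = 0) :
    exp ((-I) • H) ∈ Matrix.specialUnitaryGroup (Fin 2) ℂ := by
  letI : NormedAlgebra ℚ (Matrix (Fin 2) (Fin 2) ℂ) := NormedAlgebra.restrictScalars ℚ ℂ _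
  refine Matrix.mem_specialUnitaryGroup_iff.2 ⟨?_, ?_⟩
  · refine exp_mem_unitary_of_mem_skewAdjoint (skewAdjoint.mem_iff.2 ?_)
    rw [star_smul, hsa.star_eq, star_neg, Complex.star_def, Complex.conj_I, neg_neg, neg_smul, neg_neg]
  · rw [det_exp_eq_exp_trace, Matrix.trace_smul, htr, smul_zero, exp_zero]

/-- a special unitary unit lies in the norm-one subgroup `U1` (operator norm). [folklore] -/
theorem mem_U1_of_mem_specialUnitaryGroup {C : (Matrix (Fin 2) (Fin 2) ℂ)ˣ} (hC : (C : Matrix (Fin 2) (Fin 2) ℂ) ∈ Matrix.specialUnitaryGroup (Fin 2) ℂ) :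
    C ∈ U1 (Matrix (Fin 2) (Fin 2) ℂ) := by
  letI : CStarAlgebra (Matrix (Fin 2) (Fin 2) ℂ) := {}
  have h : C ∈ unitaryUnits (Matrix (Fin 2) (Fin 2) ℂ) := by
    rw [mem_unitaryUnits]
    exact Matrix.specialUnitaryGroup_le_unitaryGroup hC
  exact unitaryUnits_le_U1 h

end SU2

/-! ## §3 ★★★ The supplier door -/

variable {F : T3Family} {n K : ℕ}

open Classical in
/-- ★★★ **THE SUPPLIER DOOR OF (A-1): THE FamilyDoor's PER-SITE ∃-BLOCK FROM ITS CONTENT ROWS.**  See the module docstring: inputs = J1b's window letters, the torus gauge `g`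
with F3's effective-gauge tower `κf` (`hκfs`, `hκf0`), the towers `ν`, `gs′` ((T1)∕(T2)), N05's `ℤ³` data `(A, λ)`; displayed rows (hAchart) (hnear) (hLanW) (htop) (hCsu) (hlam) (hg)
(hX1) (hX2); conclusion = the twelve rows of ✓`HalvingP1FlatCoreFamilyDoor.p1FlatPillar'_room_of_suppliers`'s `hSup` at the corner `a`, witnessed by `w := (C·κf m 0·g)⁻¹ ∘ cover`,
`X := C·logCfg η W^λ·C⁻¹`, `μ := C·μ₀·C⁻¹`, `h′ := κf m 0`, `κ′ := κf m`, `m := ((−i)λ) ∘ rep`, `C := (gs′ k y₀)⁻¹ ν k y₀`.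
[cite: Balaban1985RegularSpaces, Thm 2 p.83, (1.36)-(1.38) p.82, (1.84)-(1.91) pp.90-98, (1.107)-(1.108) p.94; Balaban1985Averaging, (8) p.19, (55)-(57) p.27, (110) p.34; Balaban1985Variational, (150)-(156) pp.301-302] -/
theorem hSup_of_contentRows (hnK : n < K) (x₀ : Site (F.P K) 0) (ρ S M : ℕ) (hM : 1 ≤ M) (hS : 2 ≤ S)
    {a : LSite (F.P K).d} {M' ρ' : ℕ} (h0 : ρ + M ≤ ρ' + 1) (h1 : (F.P K).L + S + M ≤ ρ' + 2)
    (ha : ∀ ν, a ν ≤ ((iterBlockOf (K - n) x₀ ν).val : ℤ) ∧ ((iterBlockOf (K - n) x₀ ν).val : ℤ) ≤ a ν + M' - 1)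
    (hroomW : 2 * ((F.P K).L ^ (K - n) * (M' + 1) + ρ' * gs (F.P K).L (K - n)) ≤ (F.P K).sitesPerDir 0)
    (U : GaugeField (F.P K) 0 (Matrix.specialUnitaryGroup (Fin 2) ℂ)) {ε₀ B₁ : ℝ} (hε₀ : 0 < ε₀) (hB₁ : 0 ≤ B₁)
    -- [torus side] the pre-gauge of the charted iterate, F3's effective-gauge tower, the accumulated frames, the pulled-back pre-gauge
    (g : GaugeTransf (F.P K) 0 (Matrix (Fin 2) (Fin 2) ℂ)ˣ)
    (κf : (Site (F.P K) 0 → Matrix (Fin 2) (Fin 2) ℂ) → (i : ℕ) → GaugeTransf (F.P K) i (Matrix (Fin 2) (Fin 2) ℂ)ˣ)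
    (hκfs : ∀ (m : Site (F.P K) 0 → Matrix (Fin 2) (Fin 2) ℂ) (i : ℕ) (y : Site (F.P K) (i + 1)),
      κf m (i + 1) y = (vframeU (gaugeActT (κf m i) (dbarIterU i (gaugeActT g (unitsField (toUField U))))) y)⁻¹ * κf m i (emb y) *
        vframeU (dbarIterU i (gaugeActT g (unitsField (toUField U)))) y)
    (hκf0 : ∀ (m : Site (F.P K) 0 → Matrix (Fin 2) (Fin 2) ℂ) (x : Site (F.P K) 0), ((κf m 0 x : (Matrix (Fin 2) (Fin 2) ℂ)ˣ) : Matrix (Fin 2) (Fin 2) ℂ) = exp (m x))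
    (ν : (i : ℕ) → Site (F.P K) i → (Matrix (Fin 2) (Fin 2) ℂ)ˣ) (hν0 : ∀ s, ν 0 s = 1)
    (hνs : ∀ (i : ℕ) (y : Site (F.P K) (i + 1)), ν (i + 1) y = ν i (emb y) * vframeU (dbarIterU i (gaugeActT g (unitsField (toUField U)))) y)
    (gs' : (i : ℕ) → GaugeTransf (F.P K) i (Matrix (Fin 2) (Fin 2) ℂ)ˣ) (hg0 : gs' 0 = g)
    (hgs : ∀ (i : ℕ) (y : Site (F.P K) (i + 1)), gs' (i + 1) y = gs' i (emb y))
    -- [N05's ℤ³ side] the input one-form and the Landau gauge function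
    (A : LSite (F.P K).d → Fin (F.P K).d → Matrix (Fin 2) (Fin 2) ℂ) (lam : LSite (F.P K).d → Matrix (Fin 2) (Fin 2) ℂ)
    -- CONTENT ROWS
    (hAchart : ∀ z ∈ cube (F.P K).L a M' ρ' (K - n) 0, ∀ ν' : Fin (F.P K).d,
      transl (0 : Site (F.P K) 0) z ∈ cubeSetM x₀ (K - n) ρ S M 0 → (transl (0 : Site (F.P K) 0) z).shift ν' ∈ cubeSetM x₀ (K - n) ρ S M 0 →
      cfgExp (((F.L : ℝ)⁻¹) ^ (K - n)) A z ν' = gaugeActT g (unitsField (toUField U)) ⟨transl 0 z, ν'⟩)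
    (hnear : ∀ z ∈ cube (F.P K).L a M' ρ' (K - n) 0, ∀ ν' : Fin (F.P K).d,
      transl (0 : Site (F.P K) 0) z ∈ cubeSetM x₀ (K - n) ρ S M 0 → (transl (0 : Site (F.P K) 0) z).shift ν' ∈ cubeSetM x₀ (K - n) ρ S M 0 →
      ‖((mgauge (1 : LSite (F.P K).d → Fin (F.P K).d → (Matrix (Fin 2) (Fin 2) ℂ)ˣ) (gaugeExp lam)⁻¹ (cfgExp (((F.L : ℝ)⁻¹) ^ (K - n)) A) z ν' :
        (Matrix (Fin 2) (Fin 2) ℂ)ˣ) : Matrix (Fin 2) (Fin 2) ℂ) - 1‖ ≤ 1 / 4)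
    (hLanW : IsLandau138W (F.P K).L (K - n) (((F.L : ℝ)⁻¹) ^ (K - n)) (cube (F.P K).L a M' ρ' (K - n) 0) (cubeLamS (F.P K).L a M' ρ' (K - n) (K - n))
      (1 : LSite (F.P K).d → Fin (F.P K).d → (Matrix (Fin 2) (Fin 2) ℂ)ˣ)
      (mgauge (1 : LSite (F.P K).d → Fin (F.P K).d → (Matrix (Fin 2) (Fin 2) ℂ)ˣ) (gaugeExp lam)⁻¹ (cfgExp (((F.L : ℝ)⁻¹) ^ (K - n)) A)))
    (htop : ∀ yc ∈ cubeLamS (F.P K).L a M' ρ' (K - n) (K - n) (K - n),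
      κf (((-I) • lam) ∘ fun s : Site (F.P K) 0 => lift (F.P K) x₀ + rel x₀ s) (K - n) (coverAt (F.P K) (K - n) yc) =
        axialT (dbarIterU (K - n) (gaugeActT g (unitsField (toUField U)))) (iterBlockOf (K - n) x₀) (coverAt (F.P K) (K - n) yc))
    (hCsu : (((gs' (K - n) (iterBlockOf (K - n) x₀))⁻¹ * ν (K - n) (iterBlockOf (K - n) x₀) : (Matrix (Fin 2) (Fin 2) ℂ)ˣ) :
      Matrix (Fin 2) (Fin 2) ℂ) ∈ Matrix.specialUnitaryGroup (Fin 2) ℂ)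
    (hlam : ∀ z : LSite (F.P K).d, IsSelfAdjoint (lam z) ∧ (lam z).trace = 0)
    (hg : ∀ s : Site (F.P K) 0, ((g s : (Matrix (Fin 2) (Fin 2) ℂ)ˣ) : Matrix (Fin 2) (Fin 2) ℂ) ∈ Matrix.specialUnitaryGroup (Fin 2) ℂ)
    (hX1 : ∀ j, j ≤ K - n → ∀ z ∈ cube (F.P K).L a M' ρ' (K - n) j, ∀ ν' : Fin (F.P K).d,
      (F.L : ℝ) ^ j * ((F.L : ℝ)⁻¹) ^ (K - n) *
        ‖logCfg (((F.L : ℝ)⁻¹) ^ (K - n)) (mgauge (1 : LSite (F.P K).d → Fin (F.P K).d → (Matrix (Fin 2) (Fin 2) ℂ)ˣ) (gaugeExp lam)⁻¹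
          (cfgExp (((F.L : ℝ)⁻¹) ^ (K - n)) A)) z ν'‖ ≤ B₁ * ε₀)
    (hX2 : ∀ j, j ≤ K - n → ∀ z ∈ cube (F.P K).L a M' ρ' (K - n) j, ∀ ν' μ' : Fin (F.P K).d,
      z + e μ' ∈ cube (F.P K).L a M' ρ' (K - n) 0 →
      ((F.L : ℝ) ^ j * ((F.L : ℝ)⁻¹) ^ (K - n)) ^ 2 * (F.L : ℝ) ^ (K - n) *
        ‖logCfg (((F.L : ℝ)⁻¹) ^ (K - n)) (mgauge (1 : LSite (F.P K).d → Fin (F.P K).d → (Matrix (Fin 2) (Fin 2) ℂ)ˣ) (gaugeExp lam)⁻¹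
            (cfgExp (((F.L : ℝ)⁻¹) ^ (K - n)) A)) (z + e μ') ν' -
          logCfg (((F.L : ℝ)⁻¹) ^ (K - n)) (mgauge (1 : LSite (F.P K).d → Fin (F.P K).d → (Matrix (Fin 2) (Fin 2) ℂ)ˣ) (gaugeExp lam)⁻¹
            (cfgExp (((F.L : ℝ)⁻¹) ^ (K - n)) A)) z ν'‖ ≤ B₁ * ε₀) :
    ∃ (w : LSite (F.P K).d → Matrix.specialUnitaryGroup (Fin 2) ℂ) (X : LSite (F.P K).d → Fin (F.P K).d → Matrix (Fin 2) (Fin 2) ℂ)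
      (μ : ℕ → LSite (F.P K).d → Matrix (Fin 2) (Fin 2) ℂ)
      (g h' : GaugeTransf (F.P K) 0 (Matrix (Fin 2) (Fin 2) ℂ)ˣ) (κ' : (i : ℕ) → GaugeTransf (F.P K) i (Matrix (Fin 2) (Fin 2) ℂ)ˣ)
      (ν : (i : ℕ) → Site (F.P K) i → (Matrix (Fin 2) (Fin 2) ℂ)ˣ) (gs' : (i : ℕ) → GaugeTransf (F.P K) i (Matrix (Fin 2) (Fin 2) ℂ)ˣ),
      (∀ z ∈ cube (F.P K).L a M' ρ' (K - n) 0, ∀ ν : Fin (F.P K).d,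
        transl (0 : Site (F.P K) 0) z ∈ cubeSetM x₀ (K - n) ρ S M 0 → (transl (0 : Site (F.P K) 0) z).shift ν ∈ cubeSetM x₀ (K - n) ρ S M 0 →
        ‖(((Unitary.toUnits (suIncl (w z)))⁻¹ * unitsField (toUField U) ⟨transl 0 z, ν⟩ * Unitary.toUnits (suIncl (w (z + e ν))) :
            (Matrix (Fin 2) (Fin 2) ℂ)ˣ) : Matrix (Fin 2) (Fin 2) ℂ) - 1‖ ≤ 1 / 4) ∧
      (∀ z ∈ cube (F.P K).L a M' ρ' (K - n) 0, ∀ ν : Fin (F.P K).d,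
        transl (0 : Site (F.P K) 0) z ∈ cubeSetM x₀ (K - n) ρ S M 0 → (transl (0 : Site (F.P K) 0) z).shift ν ∈ cubeSetM x₀ (K - n) ρ S M 0 →
        I • ((((F.L : ℝ)⁻¹) ^ (K - n)) • X z ν) = mlog (((Unitary.toUnits (suIncl (w z)))⁻¹ * unitsField (toUField U) ⟨transl 0 z, ν⟩ *
            Unitary.toUnits (suIncl (w (z + e ν))) : (Matrix (Fin 2) (Fin 2) ℂ)ˣ) : Matrix (Fin 2) (Fin 2) ℂ)) ∧
      (∀ z ∈ cube (F.P K).L a M' ρ' (K - n) 0,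
        covLap (((F.L : ℝ)⁻¹) ^ (K - n)) (1 : LSite (F.P K).d → Fin (F.P K).d → (Matrix (Fin 2) (Fin 2) ℂ)ˣ)
            ((cube (F.P K).L a M' ρ' (K - n) 0).indicator
              (covDivB (((F.L : ℝ)⁻¹) ^ (K - n)) (1 : LSite (F.P K).d → Fin (F.P K).d → (Matrix (Fin 2) (Fin 2) ℂ)ˣ) X)) z =
          QT (F.P K).L (K - n) (cubeLamS (F.P K).L a M' ρ' (K - n) (K - n))
            (1 : LSite (F.P K).d → Fin (F.P K).d → (Matrix (Fin 2) (Fin 2) ℂ)ˣ) μ z) ∧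
      κ' 0 = h' ∧
      (∀ (i : ℕ) (y : Site (F.P K) (i + 1)),
        κ' (i + 1) y = (vframeU (gaugeActT (κ' i) (dbarIterU i (gaugeActT g (unitsField (toUField U))))) y)⁻¹ * κ' i (emb y) *
          vframeU (dbarIterU i (gaugeActT g (unitsField (toUField U)))) y) ∧
      (∀ s, ν 0 s = 1) ∧
      (∀ (i : ℕ) (y : Site (F.P K) (i + 1)), ν (i + 1) y = ν i (emb y) * vframeU (dbarIterU i (gaugeActT g (unitsField (toUField U)))) y) ∧
      gs' 0 = g ∧ (∀ (i : ℕ) (y : Site (F.P K) (i + 1)), gs' (i + 1) y = gs' i (emb y)) ∧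
      (∀ s, (Unitary.toUnits (suIncl (w (lift (F.P K) x₀ + rel x₀ s))))⁻¹ =
        ((gs' (K - n) (iterBlockOf (K - n) x₀))⁻¹ * ν (K - n) (iterBlockOf (K - n) x₀)) * h' s * g s) ∧
      (∀ yc ∈ cubeLamS (F.P K).L a M' ρ' (K - n) (K - n) (K - n),
        κ' (K - n) (coverAt (F.P K) (K - n) yc) =
          axialT (dbarIterU (K - n) (gaugeActT g (unitsField (toUField U)))) (iterBlockOf (K - n) x₀) (coverAt (F.P K) (K - n) yc)) ∧
      (∀ wt : ℕ → PBond (F.P K) 0 → ℝ, IsLevWeight F n K (cubeSeqMT3 F n K x₀ ρ S M hM) wt →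
        (∀ b : PBond (F.P K) 0, wt 1 b *
          ‖(fun b : PBond (F.P K) 0 => if b.src ∈ cubeSetM x₀ (K - n) ρ S M 0 ∧ b.tgt ∈ cubeSetM x₀ (K - n) ρ S M 0 then
            X (lift (F.P K) x₀ + rel x₀ b.src) b.dir else 0) b‖ ≤ B₁ * ε₀) ∧
        (∀ (b : PBond (F.P K) 0) (ν' : Fin (F.P K).d), wt 2 b * (F.L : ℝ) ^ (K - n) *
          ‖(fun b : PBond (F.P K) 0 => if b.src ∈ cubeSetM x₀ (K - n) ρ S M 0 ∧ b.tgt ∈ cubeSetM x₀ (K - n) ρ S M 0 then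
              X (lift (F.P K) x₀ + rel x₀ b.src) b.dir else 0) ⟨b.src.shift ν', b.dir⟩ -
            (fun b : PBond (F.P K) 0 => if b.src ∈ cubeSetM x₀ (K - n) ρ S M 0 ∧ b.tgt ∈ cubeSetM x₀ (K - n) ρ S M 0 then
              X (lift (F.P K) x₀ + rel x₀ b.src) b.dir else 0) b‖ ≤ B₁ * ε₀)) := by
  have hk : K - n ≤ (F.P K).m + (F.P K).K := FlatMinimizerH.le_T3 F n K
  have hL0 : (F.L : ℝ) ≠ 0 := Nat.cast_ne_zero.2 (F.P K).L_pos.ne'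
  -- letters
  set η : ℝ := ((F.L : ℝ)⁻¹) ^ (K - n) with hηdef
  have hη : η ≠ 0 := pow_ne_zero _ (inv_ne_zero hL0)
  set y₀ : Site (F.P K) (K - n) := iterBlockOf (K - n) x₀ with hy₀
  set W₁ : GaugeField (F.P K) 0 (Matrix (Fin 2) (Fin 2) ℂ)ˣ := gaugeActT g (unitsField (toUField U)) with hW₁
  set rep : Site (F.P K) 0 → LSite (F.P K).d := fun s => lift (F.P K) x₀ + rel x₀ s with hrep
  set m : Site (F.P K) 0 → Matrix (Fin 2) (Fin 2) ℂ := ((-I) • lam) ∘ rep with hm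
  set C : (Matrix (Fin 2) (Fin 2) ℂ)ˣ := (gs' (K - n) y₀)⁻¹ * ν (K - n) y₀ with hC
  set Wl : LSite (F.P K).d → Fin (F.P K).d → (Matrix (Fin 2) (Fin 2) ℂ)ˣ :=
    mgauge (1 : LSite (F.P K).d → Fin (F.P K).d → (Matrix (Fin 2) (Fin 2) ℂ)ˣ) (gaugeExp lam)⁻¹ (cfgExp η A) with hWl
  set X : LSite (F.P K).d → Fin (F.P K).d → Matrix (Fin 2) (Fin 2) ℂ := fun z ι => conjR C (logCfg η Wl z ι) with hX
  set G : Site (F.P K) 0 → (Matrix (Fin 2) (Fin 2) ℂ)ˣ := fun s => C * κf m 0 s * g s with hG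
  -- the bottom of the effective-gauge tower in `SU(2)` letters
  have hκ0 : ∀ s, κf m 0 s = (gaugeExp lam (rep s))⁻¹ := by
    intro s
    apply Units.ext
    rw [hκf0, gaugeExp, val_inv_expUnit, val_expUnit, hm, Function.comp_apply, Pi.smul_apply, neg_smul]
  have hCU1 : C ∈ U1 (Matrix (Fin 2) (Fin 2) ℂ) := mem_U1_of_mem_specialUnitaryGroup hCsu
  -- §2: the composite gauge is `SU(2)`-valued
  have hGsu : ∀ s, ((G s : (Matrix (Fin 2) (Fin 2) ℂ)ˣ) : Matrix (Fin 2) (Fin 2) ℂ) ∈ Matrix.specialUnitaryGroup (Fin 2) ℂ := by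
    intro s
    rw [hG]
    dsimp only
    rw [Units.val_mul, Units.val_mul]
    refine Submonoid.mul_mem _ (Submonoid.mul_mem _ hCsu ?_) (hg s)
    rw [hκf0, hm, Function.comp_apply, Pi.smul_apply]
    exact exp_neg_I_smul_mem_specialUnitaryGroup (hlam _).1 (hlam _).2
  obtain ⟨w, hwz, hws⟩ := exists_w_of_su2 x₀ G hGsu
  -- §1: the Landau window of the conjugated one-form
  have hLan0 : IsLandau138 (F.P K).L (K - n) η (cube (F.P K).L a M' ρ' (K - n) 0) (cubeLamS (F.P K).L a M' ρ' (K - n) (K - n))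
      (1 : LSite (F.P K).d → Fin (F.P K).d → (Matrix (Fin 2) (Fin 2) ℂ)ˣ) (logCfg η Wl) := hLanW
  obtain ⟨μ, hμ⟩ := isLandau138_one_conjR C hLan0
  -- the gauged window field IS `C·W^λ(z,ν)·C⁻¹`
  have hgauged : ∀ z ∈ cube (F.P K).L a M' ρ' (K - n) 0, ∀ ν' : Fin (F.P K).d,
      transl (0 : Site (F.P K) 0) z ∈ cubeSetM x₀ (K - n) ρ S M 0 → (transl (0 : Site (F.P K) 0) z).shift ν' ∈ cubeSetM x₀ (K - n) ρ S M 0 →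
      (Unitary.toUnits (suIncl (w z)))⁻¹ * unitsField (toUField U) ⟨transl 0 z, ν'⟩ * Unitary.toUnits (suIncl (w (z + e ν'))) =
        Rc C (Wl z ν') := by
    intro z hz ν' hs1 hs2
    have hz1 : rep (transl (0 : Site (F.P K) 0) z) = z := rep_transl_eq hk hM h0 h1 ha hroomW hz hs1
    have hz2 : rep ((transl (0 : Site (F.P K) 0) z).shift ν') = z + e ν' := by
      rw [hrep]; dsimp only; rw [rep_shift hk hM h0 h1 ha hroomW hs1 ν' hs2]
      exact congrArg (· + e ν') hz1
    have hw2 : Unitary.toUnits (suIncl (w (z + e ν'))) = (G ((transl (0 : Site (F.P K) 0) z).shift ν'))⁻¹ := by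
      rw [← transl_add_e, ← hwz (z + e ν'), inv_inv]
    rw [hwz z, hw2, hG]
    dsimp only
    rw [hκ0, hκ0, hz1, hz2, hWl, mgauge_apply, Pi.one_apply, Pi.one_apply, Rc_one_apply, Pi.inv_apply, Pi.inv_apply, inv_inv,
      hAchart z hz ν' hs1 hs2, hW₁, gaugeActT_apply, Rc]
    simp only [MonoidHom.coe_mk, OneHom.coe_mk, mul_inv_rev, inv_inv, PBond.tgt]
    group
  refine ⟨w, X, μ, g, κf m 0, κf m, ν, gs', ?_, ?_, hμ, rfl, hκfs m, hν0, hνs, hg0, hgs, hws, htop, ?_⟩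
  · -- hWnear
    intro z hz ν' hs1 hs2
    rw [hgauged z hz ν' hs1 hs2]
    have h : ((Rc C (Wl z ν') : (Matrix (Fin 2) (Fin 2) ℂ)ˣ) : Matrix (Fin 2) (Fin 2) ℂ) - 1 =
        conjR C (((Wl z ν' : (Matrix (Fin 2) (Fin 2) ℂ)ˣ) : Matrix (Fin 2) (Fin 2) ℂ) - 1) := by
      rw [conjR_sub, conjR_one, conjR_apply, B7Eq92Concrete.Rc_apply, Units.val_mul, Units.val_mul]
    rw [h]
    exact (norm_conjR_le hCU1 _).trans (hnear z hz ν' hs1 hs2)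
  · -- hX
    intro z hz ν' hs1 hs2
    rw [hgauged z hz ν' hs1 hs2, hX, B7Eq92Concrete.mlog_Rc, ← conjR_apply]
    dsimp only
    rw [logCfg, conjR_smul_real, conjR_smul, smul_smul, mul_inv_cancel₀ hη, one_smul, smul_smul, mul_inv_cancel₀ Complex.I_ne_zero, one_smul]
  · -- hsize, from (R4) on `X₀` moved through the conjugation
    have hc : 0 ≤ B₁ * ε₀ := mul_nonneg hB₁ hε₀.le
    refine hsize_of_windowSizes hnK x₀ ρ S M hM hS h0 h1 ha hroomW X hc ?_ ?_
    · intro j hj z hz ν'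
      have h := hX1 j hj z hz ν'
      refine le_trans ?_ h
      have hw : 0 ≤ (F.L : ℝ) ^ j * ((F.L : ℝ)⁻¹) ^ (K - n) := by positivity
      exact mul_le_mul_of_nonneg_left (norm_conjR_le hCU1 _) hw
    · intro j hj z hz ν' μ' hzμ
      have h := hX2 j hj z hz ν' μ' hzμ
      refine le_trans ?_ h
      have hw : 0 ≤ ((F.L : ℝ) ^ j * ((F.L : ℝ)⁻¹) ^ (K - n)) ^ 2 * (F.L : ℝ) ^ (K - n) := by positivity
      refine mul_le_mul_of_nonneg_left ?_ hw
      rw [hX]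
      dsimp only
      rw [← conjR_sub]
      exact norm_conjR_le hCU1 _

end Summit.QuantumFields.YangMills.Theorems.HalvingP1FlatCoreSupplierDoor

end
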